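import Literature.IUT.HodgeArakelov.DihedralCuspToy
import Literature.IUT.HodgeArakelov.CyclicToyEtaleThetaData
import Literature.IUT.HodgeArakelov.Def23StructuresIff

/-!
# A CLOSED tower on which `FlTorsorStructure` — and the whole [IUTchII] Def 2.3 (iii)–(v) existence predicate
# `Def23_structures` — is inhabited (the DIHEDRAL `𝔽_l^{⋊±}`-TORSOR TOY)

S. Mochizuki, *Inter-universal Teichmüller theory II*, kurims manuscript (Dec. 2020), §2 Def 2.3 (i) p. 67 (indices
`[Δ̂^±_v : Δ̂_v] = l`, `[Δ̂^cor_v : Δ̂^±_v] = 2l`), (iii) p. 68 (`LabCusp^±(Π_⊆)`), (v) p. 69 («a natural `𝔽^±_l`-torsor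
structure on `LabCusp^±(Π_⊆)` … a natural outer isomorphism `Π_⊇/Π_⊆ ≅ 𝔽_l^{⋊±}`») [claim: Mochizuki2012, status:
disputed] (IUTchII §2 Def 2.3 (v), kurims p.69) (D-0012 claim key; nothing printed is asserted here).

CONSISTENCY WITNESS, TOY — consistency ≠ faithfulness; no side taken on anything printed.  abc-iut-L6-t1's interface
`FlTorsorStructure C` ([IUTchII] Def 2.3 (v); `LabelClassesOfCusps.lean`) had NO absolute kernel inhabitant: by
`FlTorsorStructure.nonempty_iff` (abc-iut-w5-d219, p419621) it is inhabited iff BOTH `Π̂^cor_v/Π̂^±_v ≃* 𝔽_l^{⋊±}`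
(NONABELIAN for `l ≥ 3`) and `|LabCusp^±(Π̂^±_v)| = l`; every closed tower so far (`PlusMinusTowerCyclicToy`,
`DihedralCuspToy`) has `Π̂^cor_v/Π̂^±_v` ABELIAN, so `FlTorsorStructure` is EMPTY over them.  This file builds the
**dihedral `𝔽_l^{⋊±}`-torsor toy** over the SAME setting / coverings as the dihedral cusp toy (`DihedralCuspToy.dSetting`,
`dBadPlaceSetting`, `dCoverings`: `l` an odd prime, `m := 3^l`, `Π_v = Π^±_v = Π^tp_{X_v} := D_m` discrete, `G_v := 1`,
`k := ℂ`), with the NEW tower `Π̂^cor_v := D_m × (ℤ/l × D_l) ⊇ Π̂^±_v := D_m × (ℤ/l × 1) ⊇ Π̂_v := D_m × 1 ⊇ Π_v`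
(printed indices `l`, `2l`), so that `Π̂^cor_v/Π̂^±_v ≅ D_l ≅ 𝔽_l^{⋊±}` — `dihedralEquivFlPM : D_l ≃* 𝔽_l^{⋊±}`
(`r^i ↦ (z ↦ z + i)`, `s r^i ↦ (z ↦ −z − i)`): the label group of [IUTchI] Def 6.1 (i) IS the dihedral group of order
`2l`, PROVED over Mathlib.  The cuspidal inertia subgroups of any `Π_⊆` are declared to be the `l` dihedral subgroups
`K_{3^t} × 1 = ⟨r^{3^t}, s⟩ × 1` (`t ∈ ℤ/l`) it contains (as in `DihedralCuspToy`); for every `Π_⊇ = D_m × R`,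
`N_{Π_⊇}(K_{3^t} × 1) = K_{3^t} × R` (`normalizer_prod` + `DihedralCuspToyGroup.normalizer_dsub_eq`, `m` odd), pairwise
NON-conjugate (rotation content), so the typed `labelRel` separates the `l` cusps at BOTH printed levels:
`labCuspEquivV : ℤ/l ≃ LabCusp^±(Π_v)`, `labCuspEquivPM : ℤ/l ≃ LabCusp^±(Π̂^±_v)`.  Whence, by the three NV
reduction certificates imported BY NAME (`FlTorsorStructure.nonempty_of_isos` p419621,
`LabCuspStructure.nonempty_iff_nonempty_equiv`, `def23_structures_of_isos` p420904): `nonempty_flTorsorStructure`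
(FIRST absolute inhabitant of `FlTorsorStructure`), `nonempty_labCuspStructure`, `def23_structures` (the Def 2.3
(iii)–(v) EXISTENCE PREDICATE `Def23_structures Dec C` HOLDS over this `(W, C)` for every `D`, `Dec` — node
IUTchII:Def2.3(v), first absolute witness) and the closed instance `exists_def23_structures` (`l = 3`, `p = 5`).
HONEST LIMITS: all groups finite and discrete (in print `Π_v` is an infinite tempered group, `G_v = Gal(K̄_v/K_v)`);
the cusp predicate is a finite list, not closed under conjugation; the field `FlTorsorStructure.conjAct` is READ OFF
the chart by the affine law exactly as in p419621 (whose reading note applies verbatim: the typed interface does not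
tie `conjAct` to conjugation — here conjugation by `Π̂^cor_v` fixes every label class of `Π̂^±_v`).  No `def … : Prop`,
no named fact, no new instance (the discrete topology on Mathlib's `DihedralGroup` is the SCOPED instance of
`DihedralCuspToy`, opened here).  abc-iut cell, seat abc-iut-w5-d243 (gen 3; row «NV-L6/FlTorsorStructure-ABSOLUTE»).
[claim: Mochizuki2012, status: disputed] (IUTchII §2 Def 2.3 (v), kurims p.69)
-/

noncomputable section

namespace Literature.IUT.HodgeArakelov

namespace FlTorsorToy

open DihedralGroup DihedralCuspToy CyclicToy Literature.IUT.HodgeTheaters Multiplicative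

variable (l : ℕ)

/-! ## 0. `𝔽_l^{⋊±} ≅ D_l`: the label group of [IUTchI] Def 6.1 (i) is the dihedral group of order `2l` -/

/-- The sign `−1 ∈ {±1} = ℤˣ` acts on `𝔽_l` by negation. [cite: Mochizuki2012, IUTchI Def 6.1 (i) p.155] -/
theorem neg_one_units_smul (z : ZMod l) : (-1 : ℤˣ) • z = -z := by
  rw [Units.smul_def, Units.val_neg, Units.val_one, neg_smul, one_smul]

/-- Multiplication in `𝔽_l^{⋊±}` in affine coordinates: `(a, ε) · (b, η) = (a + ε b, ε η)`.
[cite: Mochizuki2012, IUTchI Def 6.1 (i) p.155] -/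
theorem mk_mul_mk (a b : ZMod l) (ε η : ℤˣ) : FlPM.mk a ε * FlPM.mk b η = FlPM.mk (a + ε • b) (ε * η) := rfl

/-- The map `D_l → 𝔽_l^{⋊±}`: `r^i ↦ (i, +1)` (`z ↦ z + i`), `s r^i ↦ (−i, −1)` (`z ↦ −z − i`).
[cite: Mochizuki2012, IUTchI Def 6.1 (i) p.155] -/
def dihedralToFlPM : DihedralGroup l → FlPM l
  | r i => FlPM.mk i 1
  | sr i => FlPM.mk (-i) (-1)

/-- The map `𝔽_l^{⋊±} → D_l`: `(a, +1) ↦ r^a`, `(a, −1) ↦ s r^{−a}`. [cite: Mochizuki2012, IUTchI Def 6.1 (i) p.155] -/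
def flPMToDihedral (x : FlPM l) : DihedralGroup l :=
  if x.right = 1 then r x.left.toAdd else sr (-x.left.toAdd)

/-- `D_l → 𝔽_l^{⋊±}` is multiplicative (the four cases of the dihedral multiplication table).
[cite: Mochizuki2012, IUTchI Def 6.1 (i) p.155] -/
theorem dihedralToFlPM_mul (a b : DihedralGroup l) :
    dihedralToFlPM l (a * b) = dihedralToFlPM l a * dihedralToFlPM l b := by
  rcases a with i | i <;> rcases b with j | j
  · simp only [r_mul_r, dihedralToFlPM, mk_mul_mk, one_smul, one_mul]
  · simp only [r_mul_sr, dihedralToFlPM, mk_mul_mk, one_smul, one_mul]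
    exact congrArg (FlPM.mk · (-1)) (by ring)
  · simp only [sr_mul_r, dihedralToFlPM, mk_mul_mk, neg_one_units_smul, mul_one]
    exact congrArg (FlPM.mk · (-1)) (by ring)
  · simp only [sr_mul_sr, dihedralToFlPM, mk_mul_mk, neg_one_units_smul, neg_neg, Int.units_mul_self]
    exact congrArg (FlPM.mk · 1) (by ring)

/-- **`D_l ≃* 𝔽_l^{⋊±}`**: the label group `𝔽_l ⋊ {±1}` of [IUTchI] Def 6.1 (i) is the dihedral group of order `2l`.
[cite: Mochizuki2012, IUTchI Def 6.1 (i) p.155] -/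
def dihedralEquivFlPM : DihedralGroup l ≃* FlPM l where
  toFun := dihedralToFlPM l
  invFun := flPMToDihedral l
  left_inv g := by
    rcases g with i | i
    · simp [dihedralToFlPM, flPMToDihedral, FlPM.mk]
    · simp [dihedralToFlPM, flPMToDihedral, FlPM.mk]
  right_inv x := by
    obtain ⟨n, ε⟩ := x
    rcases Int.units_eq_one_or ε with rfl | rfl
    · simp [dihedralToFlPM, flPMToDihedral, FlPM.mk]
    · have h : (-1 : ℤˣ) ≠ 1 := by decide
      simp [dihedralToFlPM, flPMToDihedral, FlPM.mk, h]
  map_mul' := dihedralToFlPM_mul l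

/-! ## 1. The ambient `Π̂^cor_v := D_{3^l} × (ℤ/l × D_l)` and `Π̂^±_v := D_{3^l} × (ℤ/l × 1)` -/

/-- The second factor `ℤ/l × D_l` of the toy's `Π̂^cor_v` (order `2l²`; discrete).
[claim: Mochizuki2012, status: disputed] (IUTchII §2 Def 2.3 (i), kurims p.67) -/
abbrev Amb2 : Type := Multiplicative (ZMod l) × DihedralGroup l

/-- `Π̂^cor_v` of the toy: `D_{3^l} × (ℤ/l × D_l)`. [claim: Mochizuki2012, status: disputed] (IUTchII §2 Def 2.3 (i), kurims p.67) -/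
abbrev Cor2 : Type := Dm l × Amb2 l

/-- The subgroup `ℤ/l × 1 ⊆ ℤ/l × D_l` (so that `Π̂^±_v := D_{3^l} × (ℤ/l × 1)`).
[claim: Mochizuki2012, status: disputed] (IUTchII §2 Def 2.3 (i), kurims p.67) -/
abbrev Hl : Subgroup (Amb2 l) := (⊤ : Subgroup (Multiplicative (ZMod l))).prod ⊥

/-- `|ℤ/l × D_l| = l · 2l`. [claim: Mochizuki2012, status: disputed] (IUTchII §2 Def 2.3 (i), kurims p.67) -/
theorem card_Amb2 : Nat.card (Amb2 l) = l * (2 * l) := by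
  rw [Nat.card_prod, Nat.card_congr (toAdd : Multiplicative (ZMod l) ≃ ZMod l), Nat.card_zmod, nat_card]

/-- `[Π̂^cor_v : Π̂^±_v] = 2l`. [claim: Mochizuki2012, status: disputed] (IUTchII §2 Def 2.3 (i), kurims p.67) -/
theorem index_top_prod_Hl : ((⊤ : Subgroup (Dm l)).prod (Hl l)).index = 2 * l := by
  rw [Subgroup.index_prod, Subgroup.index_top, one_mul, Hl, Subgroup.index_prod, Subgroup.index_top, one_mul,
    Subgroup.index_bot, nat_card]

/-- `[Π̂^cor_v : Π̂_v] = l · 2l`. [claim: Mochizuki2012, status: disputed] (IUTchII §2 Def 2.3 (i), kurims p.67) -/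
theorem index_top_prod_bot : ((⊤ : Subgroup (Dm l)).prod (⊥ : Subgroup (Amb2 l))).index = l * (2 * l) := by
  rw [Subgroup.index_prod, Subgroup.index_top, one_mul, Subgroup.index_bot, card_Amb2]

/-- `[Π̂^±_v : Π̂_v] = l`. [claim: Mochizuki2012, status: disputed] (IUTchII §2 Def 2.3 (i), kurims p.67) -/
theorem relIndex_hat_pmHat (hl0 : l ≠ 0) :
    ((⊤ : Subgroup (Dm l)).prod (⊥ : Subgroup (Amb2 l))).relIndex ((⊤ : Subgroup (Dm l)).prod (Hl l)) = l := by
  have h := Subgroup.relIndex_mul_index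
    (show (⊤ : Subgroup (Dm l)).prod (⊥ : Subgroup (Amb2 l)) ≤ (⊤ : Subgroup (Dm l)).prod (Hl l) from
      Subgroup.prod_mono le_rfl bot_le)
  rw [index_top_prod_Hl, index_top_prod_bot] at h
  exact Nat.eq_of_mul_eq_mul_right (by omega) h

/-- The projection `Π̂^cor_v ↠ D_l` whose kernel is `Π̂^±_v`. [claim: Mochizuki2012, status: disputed] (IUTchII §2 Def 2.3 (v), kurims p.69) -/
def projD : Cor2 l →* DihedralGroup l := (MonoidHom.snd _ _).comp (MonoidHom.snd (Dm l) (Amb2 l))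

/-- `projD` is surjective. [claim: Mochizuki2012, status: disputed] (IUTchII §2 Def 2.3 (v), kurims p.69) -/
theorem projD_surjective : Function.Surjective (projD l) := fun d => ⟨(1, (1, d)), rfl⟩

/-- `Ker(Π̂^cor_v ↠ D_l) = Π̂^±_v`. [claim: Mochizuki2012, status: disputed] (IUTchII §2 Def 2.3 (v), kurims p.69) -/
theorem ker_projD : (projD l).ker = (⊤ : Subgroup (Dm l)).prod (Hl l) := by
  ext x
  simp only [MonoidHom.mem_ker, projD, MonoidHom.coe_comp, Function.comp_apply, MonoidHom.coe_snd, Hl,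
    Subgroup.mem_prod, Subgroup.mem_top, Subgroup.mem_bot, true_and]

/-! ## 2. The tower `Π_v = Π^±_v ⊆ Π̂_v ⊆ Π̂^±_v ⊆ Π̂^cor_v` over the dihedral cusp toy's setting and coverings -/

section Tower

variable (p : ℕ) (hl : l.Prime) (hl2 : l ≠ 2) (hp : p.Prime) (hp2 : p ≠ 2) (hpl : p ≠ l)

/-- **The toy `PlusMinusTower`** over `DihedralCuspToy.dCoverings` ([IUTchII] Def 2.3 (i) p. 67):
`Π̂^cor_v := D_{3^l} × (ℤ/l × D_l)`, `Π̂^±_v := D_{3^l} × (ℤ/l × 1)`, `Π̂_v := D_{3^l} × 1` (`⊇ Π_v = Π^±_v = D_{3^l}`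
embedded by `inl`), `G_v := 1`; printed indices `l` and `2l`. [claim: Mochizuki2012, status: disputed] (IUTchII §2 Def 2.3 (i), kurims p.67) -/
@[reducible] def fTower : PlusMinusTower (dCoverings l p hl hl2 hp hp2 hpl) where
  Corhat := TopGroup.of (Cor2 l)
  cor := ⊤
  pmHat := (⊤ : Subgroup (Dm l)).prod (Hl l)
  hat := (⊤ : Subgroup (Dm l)).prod ⊥
  emb := MonoidHom.inl (Dm l) (Amb2 l)
  emb_injective := fun a b h => (Prod.mk.inj h).1
  aug := 1
  aug_surjective := fun _ => ⟨1, Subsingleton.elim _ _⟩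
  hat_le_pmHat := Subgroup.prod_mono le_rfl bot_le
  emb_le_pmHat := by
    rintro _ ⟨h, rfl⟩
    exact Subgroup.mem_prod.mpr ⟨Subgroup.mem_top _, Subgroup.one_mem _⟩
  embP_le_hat := by
    rintro _ ⟨h, rfl⟩
    exact Subgroup.mem_prod.mpr ⟨Subgroup.mem_top _, Subgroup.one_mem _⟩
  embP_le_cor := le_top
  pmHat_normal := by rw [← ker_projD]; infer_instance
  deltaHat_normal := by rw [MonoidHom.ker_one, inf_top_eq, inf_top_eq]; infer_instance
  deltaHat_index := by
    rw [MonoidHom.ker_one, inf_top_eq, inf_top_eq]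
    exact relIndex_hat_pmHat l hl.ne_zero
  deltaPmHat_normal := by rw [MonoidHom.ker_one, inf_top_eq, ← ker_projD]; infer_instance
  deltaPmHat_index := by
    rw [MonoidHom.ker_one, inf_top_eq]
    change ((⊤ : Subgroup (Dm l)).prod (Hl l)).relIndex ⊤ = 2 * l
    rw [Subgroup.relIndex_top_right, index_top_prod_Hl]
  aug_compat := ⟨ContinuousMulEquiv.refl _, fun _ => Subsingleton.elim _ _⟩

/-- **`Π̂^cor_v/Π̂^±_v ≃* 𝔽_l^{⋊±}`** in the toy: `Π̂^±_v = Ker(Π̂^cor_v ↠ D_l)` and `D_l ≅ 𝔽_l^{⋊±}`.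
[claim: Mochizuki2012, status: disputed] (IUTchII §2 Def 2.3 (v), kurims p.69) -/
def quotIso : (fTower l p hl hl2 hp hp2 hpl).Corhat ⧸ (fTower l p hl hl2 hp hp2 hpl).pmHat ≃* FlPM l :=
  ((QuotientGroup.quotientMulEquivOfEq (ker_projD l).symm).trans
    (QuotientGroup.quotientKerEquivOfSurjective (projD l) (projD_surjective l))).trans (dihedralEquivFlPM l)

/-- `Π^±_v` of the toy is `D_m × 1`: membership. [claim: Mochizuki2012, status: disputed] (IUTchII §2 Def 2.3 (i), kurims p.67) -/
theorem mem_piPM_iff {x : Cor2 l} :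
    x ∈ (fTower l p hl hl2 hp hp2 hpl).piPM ↔ x.2 ∈ (⊥ : Subgroup (Amb2 l)) := by
  rw [Subgroup.mem_bot]
  exact ⟨by rintro ⟨h, rfl⟩; rfl, fun hx => ⟨x.1, Prod.ext rfl hx.symm⟩⟩

/-- `Π̂^±_v` of the toy is `D_m × (ℤ/l × 1)`: membership. [claim: Mochizuki2012, status: disputed] (IUTchII §2 Def 2.3 (i), kurims p.67) -/
theorem mem_pmHat_iff {x : Cor2 l} : x ∈ (fTower l p hl hl2 hp hp2 hpl).pmHat ↔ x.2 ∈ Hl l := by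
  change x ∈ (⊤ : Subgroup (Dm l)).prod (Hl l) ↔ _
  rw [Subgroup.mem_prod]
  exact ⟨fun h => h.2, fun h => ⟨Subgroup.mem_top _, h⟩⟩

/-- `Π_v = Π^±_v` in the toy (the inclusion `Π_v ↪ Π^tp_{X_v}` is the identity).
[claim: Mochizuki2012, status: disputed] (IUTchII §2 Def 2.3 (i), kurims p.67) -/
theorem piV_eq_piPM : (fTower l p hl hl2 hp hp2 hpl).piV = (fTower l p hl hl2 hp hp2 hpl).piPM := by
  change ((MonoidHom.inl (Dm l) (Amb2 l)).comp (MonoidHom.id (Dm l))).range = (MonoidHom.inl (Dm l) (Amb2 l)).range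
  rw [MonoidHom.comp_id]

/-! ## 3. The cusps `K_{3^t} × 1` and their normalisers in `D_m × R` -/

/-- The `t`-th cuspidal inertia subgroup of the toy: `K_{3^{t}} × 1 ⊆ D_m × 1 = Π_v` (`t ∈ ℤ/l` read as `0 ≤ t < l`).
[claim: Mochizuki2012, status: disputed] (IUTchII §2 Def 2.3 (ii), kurims p.68) -/
def cusp (t : ZMod l) : Subgroup (Cor2 l) := (dsub (3 ^ l) ((3 ^ t.val : ℕ) : ZMod (3 ^ l))).prod ⊥

/-- Cusps lie in every `D_m × R`. [claim: Mochizuki2012, status: disputed] (IUTchII §2 Def 2.3 (ii), kurims p.68) -/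
theorem cusp_le_of_iff {R : Subgroup (Amb2 l)} {Q : Subgroup (Cor2 l)} (hQ : ∀ x, x ∈ Q ↔ x.2 ∈ R) (t : ZMod l) :
    cusp l t ≤ Q := by
  intro x hx
  rw [hQ x, (Subgroup.mem_bot).mp (Subgroup.mem_prod.mp hx).2]
  exact Subgroup.one_mem R

/-- **The toy `CuspidalInertiaData`**: the cuspidal inertia subgroups of any `Π_⊆` are the `K_{3^t} × 1` it contains.
[claim: Mochizuki2012, status: disputed] (IUTchII §2 Def 2.3 (ii), kurims p.68) -/
@[reducible] def fCusps : CuspidalInertiaData (fTower l p hl hl2 hp hp2 hpl) where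
  IsCuspidalInertia Q I := I ≤ Q ∧ ∃ t : ZMod l, I = cusp l t
  le_of_isCuspidalInertia h := h.1

/-- **Normalisers in a direct product**: `N_{G×H}(A × B) = N_G(A) × N_H(B)`. [folklore] -/
private theorem normalizer_prod {G H : Type*} [Group G] [Group H] (A : Subgroup G) (B : Subgroup H) :
    Subgroup.normalizer ((A.prod B : Subgroup (G × H)) : Set (G × H)) =
      (Subgroup.normalizer (A : Set G)).prod (Subgroup.normalizer (B : Set H)) := by
  ext x
  rw [Subgroup.mem_prod, Subgroup.mem_normalizer_iff, Subgroup.mem_normalizer_iff, Subgroup.mem_normalizer_iff]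
  refine ⟨fun h => ⟨fun a => ?_, fun b => ?_⟩, fun h x => ?_⟩
  · simpa [Subgroup.mem_prod] using h (a, 1)
  · simpa [Subgroup.mem_prod] using h (1, b)
  · rw [Subgroup.mem_prod, Subgroup.mem_prod, h.1 x.1, h.2 x.2]
    exact Iff.rfl

/-- **`N_{D_m × R}(K_{3^t} × 1) = K_{3^t} × R`** (inside `Π̂^cor_v`; `K_{3^t}` self-normalising, `m = 3^l` odd) — the
normaliser bookkeeping of `labelRel` for every `Π_⊇ = D_m × R`. [claim: Mochizuki2012, status: disputed] (IUTchII §2 Def 2.3 (iii), kurims p.68) -/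
theorem normalizerMap_cusp {R : Subgroup (Amb2 l)} {Q : Subgroup (Cor2 l)} (hQ : ∀ x, x ∈ Q ↔ x.2 ∈ R) (t : ZMod l) :
    (Subgroup.normalizer (((cusp l t).subgroupOf Q : Subgroup Q) : Set Q)).map Q.subtype =
      (dsub (3 ^ l) ((3 ^ t.val : ℕ) : ZMod (3 ^ l))).prod R := by
  rw [← Subgroup.subgroupOf_normalizer_eq (cusp_le_of_iff l hQ t), Subgroup.subgroupOf_map_subtype, cusp,
    normalizer_prod, normalizer_dsub_eq _ (odd_three_pow l), Subgroup.normalizer_eq_top]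
  ext x
  rw [Subgroup.mem_inf, Subgroup.mem_prod, Subgroup.mem_prod, hQ x]
  exact ⟨fun h => ⟨h.1.1, h.2⟩, fun h => ⟨⟨h.1, Subgroup.mem_top _⟩, h.2⟩⟩

/-- Rotation content of conjugate normalisers: if `K_{3^t} × R = g (K_{3^s} × R) g⁻¹` in `Π̂^cor_v`, then `t ≤ s`.
[claim: Mochizuki2012, status: disputed] (IUTchII §2 Def 2.3 (iii), kurims p.68) -/
theorem val_le_of_prod_eq_map_conj (hl0 : l ≠ 0) {R : Subgroup (Amb2 l)} {s t : ZMod l} {g : Cor2 l}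
    (h : (dsub (3 ^ l) ((3 ^ t.val : ℕ) : ZMod (3 ^ l))).prod R =
      ((dsub (3 ^ l) ((3 ^ s.val : ℕ) : ZMod (3 ^ l))).prod R).map (MulAut.conj g).toMonoidHom) :
    t.val ≤ s.val := by
  haveI : NeZero l := ⟨hl0⟩
  have hmem : (r ((3 ^ s.val : ℕ) : ZMod (3 ^ l)), (1 : Amb2 l)) ∈
      (dsub (3 ^ l) ((3 ^ s.val : ℕ) : ZMod (3 ^ l))).prod R :=
    Subgroup.mem_prod.mpr ⟨r_self_mem_dsub _ _, Subgroup.one_mem _⟩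
  have hconj : g * (r ((3 ^ s.val : ℕ) : ZMod (3 ^ l)), (1 : Amb2 l)) * g⁻¹ ∈
      (dsub (3 ^ l) ((3 ^ t.val : ℕ) : ZMod (3 ^ l))).prod R := h ▸ Subgroup.mem_map.mpr ⟨_, hmem, rfl⟩
  have h1 : g.1 * r ((3 ^ s.val : ℕ) : ZMod (3 ^ l)) * g.1⁻¹ ∈ dsub (3 ^ l) ((3 ^ t.val : ℕ) : ZMod (3 ^ l)) :=
    (Subgroup.mem_prod.mp hconj).1
  rcases conj_r (3 ^ l) g.1 ((3 ^ s.val : ℕ) : ZMod (3 ^ l)) with e | e <;> rw [e] at h1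
  · exact le_of_pow_three_mem_dsub (le_of_lt (ZMod.val_lt t)) h1
  · obtain ⟨k, hk⟩ := (r_mem_dsub_iff _ _ _).mp h1
    exact le_of_pow_three_mem_dsub (le_of_lt (ZMod.val_lt t))
      ((r_mem_dsub_iff _ _ _).mpr ⟨-k, by rw [mul_neg, ← hk, neg_neg]⟩)

/-- **The label relation separates the `l` cusps at every level `Π_⊆ ⊆ Π_⊇ = D_m × R`**:
`labelRel (K_{3^s} × 1) (K_{3^t} × 1) → s = t`. [claim: Mochizuki2012, status: disputed] (IUTchII §2 Def 2.3 (iii), kurims p.68) -/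
theorem eq_of_labelRel {R : Subgroup (Amb2 l)} {Qsub Qsup : Subgroup (Cor2 l)} (hQ : ∀ x, x ∈ Qsup ↔ x.2 ∈ R)
    {s t : ZMod l} (hs : (fCusps l p hl hl2 hp hp2 hpl).IsCuspidalInertia Qsub (cusp l s))
    (ht : (fCusps l p hl hl2 hp hp2 hpl).IsCuspidalInertia Qsub (cusp l t))
    (h : labelRel (fCusps l p hl hl2 hp hp2 hpl) Qsub Qsup ⟨cusp l s, hs⟩ ⟨cusp l t, ht⟩) : s = t := by
  haveI : NeZero l := ⟨hl.ne_zero⟩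
  obtain ⟨g, -, hN⟩ := h
  have hN₀ : (dsub (3 ^ l) ((3 ^ t.val : ℕ) : ZMod (3 ^ l))).prod R =
      ((dsub (3 ^ l) ((3 ^ s.val : ℕ) : ZMod (3 ^ l))).prod R).map (MulAut.conj g).toMonoidHom := by
    have e₁ := normalizerMap_cusp l hQ t
    have e₂ := normalizerMap_cusp l hQ s
    rw [← e₁, ← e₂]
    exact hN
  have h1 := val_le_of_prod_eq_map_conj l hl.ne_zero hN₀
  have hN' : (dsub (3 ^ l) ((3 ^ s.val : ℕ) : ZMod (3 ^ l))).prod R =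
      ((dsub (3 ^ l) ((3 ^ t.val : ℕ) : ZMod (3 ^ l))).prod R).map (MulAut.conj g⁻¹).toMonoidHom := by
    rw [hN₀, map_conj_inv_map_conj]
  have h2 := val_le_of_prod_eq_map_conj l hl.ne_zero hN'
  exact ZMod.val_injective l (le_antisymm h2 h1)

/-- The cusps are distinct: `K_{3^s} × 1 = K_{3^t} × 1 → s = t`.
[claim: Mochizuki2012, status: disputed] (IUTchII §2 Def 2.3 (iii), kurims p.68) -/
theorem cusp_injective (hl0 : l ≠ 0) : Function.Injective (cusp l : ZMod l → Subgroup (Cor2 l)) := by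
  intro s t h
  haveI : NeZero l := ⟨hl0⟩
  have key : ∀ {a b : ZMod l}, cusp l a = cusp l b → b.val ≤ a.val := by
    intro a b hab
    have hmem : (r ((3 ^ a.val : ℕ) : ZMod (3 ^ l)), (1 : Amb2 l)) ∈ cusp l a :=
      Subgroup.mem_prod.mpr ⟨r_self_mem_dsub _ _, Subgroup.one_mem _⟩
    rw [hab] at hmem
    exact le_of_pow_three_mem_dsub (le_of_lt (ZMod.val_lt b)) (Subgroup.mem_prod.mp hmem).1
  exact ZMod.val_injective l (le_antisymm (key h.symm) (key h))

/-! ## 4. `LabCusp^±(Π_⊆) ≃ 𝔽_l` at every printed level -/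

/-- **`ℤ/l ≃ LabCusp^±(Π_⊆)`** for any `Π_⊆` containing the cusps and `Π_⊇ = D_m × R`: `t ↦` the class of `K_{3^t} × 1`.
[claim: Mochizuki2012, status: disputed] (IUTchII §2 Def 2.3 (iii), kurims p.68) -/
def labCuspEquivOf {R : Subgroup (Amb2 l)} (Qsub Qsup : Subgroup (Cor2 l)) (hsub : ∀ t, cusp l t ≤ Qsub)
    (hQ : ∀ x, x ∈ Qsup ↔ x.2 ∈ R) :
    ZMod l ≃ LabCuspPM (fCusps l p hl hl2 hp hp2 hpl) Qsub Qsup where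
  toFun t := Quot.mk _ ⟨cusp l t, hsub t, t, rfl⟩
  invFun := Quot.lift (fun I => Classical.choose I.2.2) (by
    rintro ⟨I, hI, s, rfl⟩ ⟨J, hJ, t, rfl⟩ h
    have hs := Classical.choose_spec (⟨s, rfl⟩ : ∃ t', cusp l s = cusp l t')
    have ht := Classical.choose_spec (⟨t, rfl⟩ : ∃ t', cusp l t = cusp l t')
    change Classical.choose (⟨s, rfl⟩ : ∃ t', cusp l s = cusp l t') =
      Classical.choose (⟨t, rfl⟩ : ∃ t', cusp l t = cusp l t')
    rw [← cusp_injective l hl.ne_zero hs, ← cusp_injective l hl.ne_zero ht]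
    exact eq_of_labelRel l p hl hl2 hp hp2 hpl hQ _ _ h)
  left_inv t := by
    change Classical.choose (⟨t, rfl⟩ : ∃ t', cusp l t = cusp l t') = t
    exact (cusp_injective l hl.ne_zero (Classical.choose_spec (⟨t, rfl⟩ : ∃ t', cusp l t = cusp l t'))).symm
  right_inv q := by
    induction q using Quot.ind with
    | mk I =>
      obtain ⟨I, hI, s, rfl⟩ := I
      change Quot.mk _ _ = Quot.mk _ _
      congr 2
      exact congrArg (cusp l)
        (cusp_injective l hl.ne_zero (Classical.choose_spec (⟨s, rfl⟩ : ∃ t', cusp l s = cusp l t'))).symm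

/-- **`LabCusp^±(Π_v) ≃ 𝔽_l`** (level `Π_v ⊆ Π^±_v` of Def 2.3 (iii)). [claim: Mochizuki2012, status: disputed] (IUTchII §2 Def 2.3 (iii), kurims p.68) -/
def labCuspEquivV :
    ZMod l ≃ LabCuspPM (fCusps l p hl hl2 hp hp2 hpl) (fTower l p hl hl2 hp hp2 hpl).piV
      (fTower l p hl hl2 hp hp2 hpl).piPM :=
  labCuspEquivOf l p hl hl2 hp hp2 hpl _ _
    (fun t => (cusp_le_of_iff l (fun _ => mem_piPM_iff l p hl hl2 hp hp2 hpl) t).trans_eq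
      (piV_eq_piPM l p hl hl2 hp hp2 hpl).symm)
    (fun _ => mem_piPM_iff l p hl hl2 hp hp2 hpl)

/-- **`LabCusp^±(Π̂^±_v) ≃ 𝔽_l`** (level `Π̂^±_v ⊆ Π̂^±_v` of Def 2.3 (v): one chart of the `𝔽^±_l`-torsor structure).
[claim: Mochizuki2012, status: disputed] (IUTchII §2 Def 2.3 (v), kurims p.69) -/
def labCuspEquivPM :
    ZMod l ≃ LabCuspPM (fCusps l p hl hl2 hp hp2 hpl) (fTower l p hl hl2 hp hp2 hpl).pmHat
      (fTower l p hl hl2 hp hp2 hpl).pmHat :=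
  labCuspEquivOf l p hl hl2 hp hp2 hpl _ _ (cusp_le_of_iff l (fun _ => mem_pmHat_iff l p hl hl2 hp hp2 hpl))
    (fun _ => mem_pmHat_iff l p hl hl2 hp hp2 hpl)

/-! ## 5. The inhabited interfaces -/

/-- **`FlTorsorStructure` IS INHABITED over the dihedral `𝔽_l^{⋊±}`-torsor toy** — the first absolute kernel inhabitant
of abc-iut-L6-t1's [IUTchII] Def 2.3 (v) interface, via abc-iut-w5-d219's `FlTorsorStructure.nonempty_of_isos`
(imported BY NAME) applied to `quotIso` and `labCuspEquivPM`. [claim: Mochizuki2012, status: disputed] (IUTchII §2 Def 2.3 (v), kurims p.69) -/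
theorem nonempty_flTorsorStructure : Nonempty (FlTorsorStructure (fCusps l p hl hl2 hp hp2 hpl)) :=
  FlTorsorStructure.nonempty_of_isos _ (quotIso l p hl hl2 hp hp2 hpl) (labCuspEquivPM l p hl hl2 hp hp2 hpl).symm

/-- **`LabCuspStructure` is inhabited over the same `(W, C)`** (via `LabCuspStructure.nonempty_iff_nonempty_equiv`).
[claim: Mochizuki2012, status: disputed] (IUTchII §2 Def 2.3 (iii), kurims p.68) -/
theorem nonempty_labCuspStructure : Nonempty (LabCuspStructure (fCusps l p hl hl2 hp hp2 hpl)) :=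
  LabCuspStructure.nonempty_iff_nonempty_equiv.mpr ⟨(labCuspEquivV l p hl hl2 hp hp2 hpl).symm⟩

/-- **The [IUTchII] Def 2.3 (iii)–(v) existence predicate `Def23_structures` HOLDS over the toy's `(W, C)`**, for every
étale-theta datum `D` and subgraph decomposition `Dec` over the dihedral setting (via abc-iut-w5-d219's
`def23_structures_of_isos`, imported BY NAME) — the first absolute witness of node IUTchII:Def2.3(v)'s predicate.
[claim: Mochizuki2012, status: disputed] (IUTchII §2 Def 2.3 (v), kurims p.69) -/
theorem def23_structures
    {D : EtaleThetaData (dBadPlaceSetting l p hl hl2 hp hp2 hpl).toThetaSetting (dBadPlaceSetting l p hl hl2 hp hp2 hpl).PiX}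
    (Dec : SubgraphDecomposition (dBadPlaceSetting l p hl hl2 hp hp2 hpl) (dCoverings l p hl hl2 hp hp2 hpl) D) :
    Def23_structures Dec (fCusps l p hl hl2 hp hp2 hpl) :=
  def23_structures_of_isos Dec _ (labCuspEquivV l p hl hl2 hp hp2 hpl).symm (quotIso l p hl hl2 hp hp2 hpl)
    (labCuspEquivPM l p hl hl2 hp hp2 hpl).symm

end Tower

/-- **Closed instance** (`l := 3`, `p := 5`): there exist, in the kernel, a bad-place setting, coverings, an étale-theta
datum, a subgraph decomposition, a `±`-tower and cuspidal inertia data over them for which `Def23_structures` holds and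
`LabCuspStructure`, `FlTorsorStructure` are inhabited. [claim: Mochizuki2012, status: disputed] (IUTchII §2 Def 2.3 (v), kurims p.69) -/
theorem exists_def23_structures :
    ∃ (S : BadPlaceSetting.{0}) (T : TemperedCoverings S S.PiX) (D : EtaleThetaData S.toThetaSetting S.PiX)
      (Dec : SubgraphDecomposition S T D) (W : PlusMinusTower T) (C : CuspidalInertiaData W),
      Def23_structures Dec C ∧ Nonempty (LabCuspStructure C) ∧ Nonempty (FlTorsorStructure C) :=
  ⟨dBadPlaceSetting 3 5 Nat.prime_three (by decide) Nat.prime_five (by decide) (by decide),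
    dCoverings 3 5 Nat.prime_three (by decide) Nat.prime_five (by decide) (by decide),
    degenerateEtaleThetaData _, degenerateDecomposition _ _ _,
    fTower 3 5 Nat.prime_three (by decide) Nat.prime_five (by decide) (by decide),
    fCusps 3 5 Nat.prime_three (by decide) Nat.prime_five (by decide) (by decide),
    def23_structures 3 5 Nat.prime_three (by decide) Nat.prime_five (by decide) (by decide) _,
    nonempty_labCuspStructure 3 5 Nat.prime_three (by decide) Nat.prime_five (by decide) (by decide),
    nonempty_flTorsorStructure 3 5 Nat.prime_three (by decide) Nat.prime_five (by decide) (by decide)⟩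

end FlTorsorToy

end Literature.IUT.HodgeArakelov

end
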